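/-
Copyright: cell `pub-balaban-gaps` (G2), seat ne6 (row NE7b), `prover-pub-balaban-gaps-ne6-g11-0`. Released under the licence of the
surrounding project.
-/
import Summits.QuantumFields.BalabanUV.T4Continuum.Spine.NE7b.CompactFibreCarrier
import Literature.MathematicalPhysics.QuantumLattice.SU2HaarSmallBall
import Literature.MathematicalPhysics.QuantumFieldTheory.Balaban1983to89.T4HaarSU2Translate

/-!
# THE CREATION-LEVEL WINDOW-VOLUME LETTER `κ(G)` BY VALUE FOR `SU(2)`: a product Haar window over the bonds of a region has mass
# `≥ (η²∕16)^{#bonds}`, so the compact-fibre price is `≤ i⁺ + #bonds·(2 log η⁻¹ + log 16)` — «O(log g⁻¹) PER DEGREE OF FREEDOM»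
# (row NE7b, node U5c; junction of the OWNER's `CompactFibreCarrier` with the TREE's `SU(2)` small-ball Haar bound)

Cell `pub-balaban-gaps` (G2 spine census) for the `pub-balaban` T⁴ crux NE7b (`T4WeightBudget.RelWeightBound`; the cell's OWN
estimate — NOT PRINTED in [Bałaban 1983–89], NOT PROVED).  Crux-route work under `Spine/NE7b/`; NOTHING of Bałaban's is named or
asserted; no `T4Continuum/Support` leaf typed; no `def`; zero `sorry`.  Imports: the OWNER's `CompactFibreCarrier`, the tree's
`QuantumLattice.SU2HaarSmallBall` (the Haar bound) and `Balaban1983to89.T4HaarSU2Translate` (`su2Quat_mul`, for §4).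

WHY.  The OWNER t4-ne7b-p1 g106's `…Spine.NE7b.CompactFibreCarrier` (RULING W-ne7bp1-g106-4) types reading (n) of the refuter's
Q-ne7bref-g68-1: at a CREATION step the near fibre is COMPACT (Haar on `G^{bonds(Z)}`), the numerator is carried by POSITIVITY alone,
and the conditional moment costs `e^{i⁺}·(∫F dκ ∕ ∫G dκ)` — «smallness on the window plus the LOG OF A VOLUME RATIO», a price PER DEGREE
OF FREEDOM (`pi_window_measure`, `neg_log_prod`, `log_volumeRatio_le`), with the per-factor window masses `p_b` left as LETTERS.  Its
NOT-HERE list names «`i⁺`, `κ(G)` from the hierarchy's windows» BY VALUE.  For the headline's gauge group `SU(2)` the TREE already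
holds the value of `κ(G)`: `Literature.MathematicalPhysics.QuantumLattice.le_haarProbability_su2_two_sub_trace_le` (typed for
Chatterjee's `SU(2)` Yang–Mills–Higgs limit, arXiv:2401.10507 Lemma 5.5, PROVED in the tree from the ball-cone description of Haar
measure): **`Haar_{SU(2)}{U : 2 − Re tr U ≤ η} ≥ η²∕16` for `0 < η ≤ 1∕4`**.  THIS FILE is the junction, [folklore] throughout:

* §1 ONE BOND.  `haar_traceWindow_toReal_ge` (the tree's bound in real form), `neg_log_haar_traceWindow_le`
  (`−log Haar(W_η) ≤ 2·log η⁻¹ + log 16`), and the dictionary `norm_su2Quat_sub_one_sq` ∕ `traceWindow_eq_quatBall`: on `SU(2)` the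
  trace deficit IS the squared distance to the identity in the unit quaternions, `‖su2Quat U − 1‖² = 2 − Re tr U`, so the trace
  window `{2 − Re tr U ≤ η}` is the ball `{‖su2Quat U − 1‖ ≤ √η}` of the tree's `SU(2) ↔ S³ ⊂ ℍ` model (`QuantumLattice.SU2Haar`) —
  the shape «`|V(b) − 1| < ε`» of a bond small-field condition.
* §2 A REGION.  For the product Haar measure on `bonds → SU(2)` (the near fibre of the tree's own `wilsonWeight`:
  `Measure.pi fun _ => haarProbability G`) and the product window: `pi_traceWindow_toReal_eq` (mass `= Haar(W_η)^{#bonds}`, the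
  OWNER's `pi_window_measure`), `pi_traceWindow_toReal_ge` (`≥ (η²∕16)^{#bonds}`), **`neg_log_pi_traceWindow_le`**
  (`−log κ(W) ≤ #bonds·(2 log η⁻¹ + log 16)`) — the per-degree-of-freedom price BY VALUE.
* §3 THE JUNCTION.  `compactFibre_moment_le_window` (the OWNER's display with the window's INDICATOR as denominator factor and a
  numerator factor `F ≤ 1` on a PROBABILITY near fibre: price `e^{i⁺}∕κ(W)`), and **`compactFibre_moment_le_SU2window`**:
  `∫ F·w·e^{−I} d(κ⊗μ) ≤ exp(i⁺ + #bonds·(2 log η⁻¹ + log 16)) · ∫ 𝟙_W·w·e^{−I} d(κ⊗μ)` for the `SU(2)` product fibre.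
* §4 THE OTHER LETTER, `i⁺`, BY VALUE.  Window bonds make window plaquettes: `norm_mul_sub_one_le` (unit quaternions:
  `‖pq − 1‖ ≤ ‖p − 1‖ + ‖q − 1‖`), `norm_su2Quat_inv_sub_one`, `norm_su2Quat_mul₄_sub_one_le`, **`traceDeficit_mul₄_le`** (four bonds in
  `W_η` ⇒ their product in `W_{16η}`), `inv_mem_traceWindow` ∕ `traceDeficit_plaquetteWord_le` (the word `U₁U₂U₃⁻¹U₄⁻¹`), `wilsonPlaquette_le_of_window` (`β(1 − ½Re tr U_p) ≤ 8βη`), **`interaction_le_of_window`**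
  (`Σ_{p ∈ s} β(1 − ½Re tr U_p) ≤ #s·8βη` — the smallness-on-the-window letter of `compactFibre_moment_le` for the Wilson plaquette terms
  whose bonds are all windowed).

HONEST REMARKS.  Which window print uses at a creation step, and at which `η = η(g_j)` (the hierarchy's bond conditions
[Balaban1989LargeFieldI] p. 178 (1.5) «χ({|V_j(y,x) − 1| < ε_j})», (1.9); [Balaban1989LargeFieldI] (1.82) p. 196 «χ′ = χ({|B′(b)| < δ′_k
for b ∈ 𝔹₀})»; read by the OWNER g106 RULING-4 and idea-1 g62 E-62-1), and that Bałaban's creation-level carrier IS the compact-fibre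
one with `I ≥ 0`, are (A3) ∕ (A1c) readings — NOT asserted here; the exponent `2` in `η²` is the tree's (the true order is `η^{3∕2}`),
any power law gives «O(log η⁻¹) per bond».  Nothing of Bałaban's is asserted, valued or discharged.  NE7b NOT PRINTED ∕ NOT PROVED;
spine PROVED 0∕9; rung (B)+1 on a FINITE torus — NOT infinite volume, NOT the mass gap, NOT Clay.
HONEST DEPENDENCY: continuum YM on T⁴ ⇐ BetaPertH ∧ nine spine estimates (0/9 proved); BetaPertH ⇐ (D1) ∧ (D4) ∧ CAP+tail;
G-an2-4 gates asym, D1 and NE2/3/4.  This file changes none of it.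
-/

set_option autoImplicit false

open MeasureTheory Real Finset
open scoped Quaternion
open Literature.MathematicalPhysics.QuantumFieldTheory (haarProbability)
open Literature.MathematicalPhysics.QuantumLattice (su2Quat norm_su2Quat quatMatrix_su2Quat le_haarProbability_su2_two_sub_trace_le
  trace_quatMatrix_re sq_norm_eq_sum_sq)
open Literature.MathematicalPhysics.QuantumFieldTheory.Balaban1983to89.T4HaarSU2Translate (su2Quat_mul)
open Summit.QuantumFields.BalabanUV.T4Continuum.NE7b.CompactFibreCarrier

namespace Summit.QuantumFields.BalabanUV.T4Continuum.NE7b.CompactFibreWindowSU2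

noncomputable section

/-! Conventions: `SU(2)` is Mathlib's `Matrix.specialUnitaryGroup (Fin 2) ℂ` throughout, and the TRACE WINDOW of half-width `η` is the plain set
`{U : Matrix.specialUnitaryGroup (Fin 2) ℂ | 2 - ((U : Matrix (Fin 2) (Fin 2) ℂ).trace).re ≤ η}` (written out in full — nothing abbreviated, nothing defined; `W_η` in the prose). -/

/-! ## §1 One bond: the trace window of `SU(2)` — Haar mass `≥ η²∕16`, hence `−log ≤ 2 log η⁻¹ + log 16`; and its quaternion shape -/

/-- The trace window is closed, hence measurable. [folklore] -/
theorem measurableSet_traceWindow (η : ℝ) : MeasurableSet {U : Matrix.specialUnitaryGroup (Fin 2) ℂ | 2 - ((U : Matrix (Fin 2) (Fin 2) ℂ).trace).re ≤ η} := by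
  refine (isClosed_le ?_ continuous_const).measurableSet
  exact continuous_const.sub (Complex.continuous_re.comp (continuous_subtype_val.matrix_trace))

/-- **THE TREE's SMALL-BALL BOUND IN REAL FORM**: `η²∕16 ≤ Haar_{SU(2)}(W_η)` for `0 < η ≤ 1∕4`
(`QuantumLattice.le_haarProbability_su2_two_sub_trace_le`). [folklore] -/
theorem haar_traceWindow_toReal_ge {η : ℝ} (hη0 : 0 < η) (hη : η ≤ 1 / 4) :
    η ^ 2 / 16 ≤ ((haarProbability (Matrix.specialUnitaryGroup (Fin 2) ℂ)) {U : Matrix.specialUnitaryGroup (Fin 2) ℂ | 2 - ((U : Matrix (Fin 2) (Fin 2) ℂ).trace).re ≤ η}).toReal :=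
  (ENNReal.ofReal_le_iff_le_toReal (measure_ne_top _ _)).1 (le_haarProbability_su2_two_sub_trace_le hη0 hη)

/-- Hence the window has positive Haar mass. [folklore] -/
theorem haar_traceWindow_toReal_pos {η : ℝ} (hη0 : 0 < η) (hη : η ≤ 1 / 4) :
    0 < ((haarProbability (Matrix.specialUnitaryGroup (Fin 2) ℂ)) {U : Matrix.specialUnitaryGroup (Fin 2) ℂ | 2 - ((U : Matrix (Fin 2) (Fin 2) ℂ).trace).re ≤ η}).toReal :=
  lt_of_lt_of_le (by positivity) (haar_traceWindow_toReal_ge hη0 hη)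

/-- A probability: the window's mass is at most `1`. [folklore] -/
theorem haar_traceWindow_toReal_le_one (η : ℝ) : ((haarProbability (Matrix.specialUnitaryGroup (Fin 2) ℂ)) {U : Matrix.specialUnitaryGroup (Fin 2) ℂ | 2 - ((U : Matrix (Fin 2) (Fin 2) ℂ).trace).re ≤ η}).toReal ≤ 1 :=
  ENNReal.toReal_le_of_le_ofReal zero_le_one (by rw [ENNReal.ofReal_one]; exact prob_le_one)

/-- **`−log Haar_{SU(2)}(W_η) ≤ 2·log η⁻¹ + log 16`** (`0 < η ≤ 1∕4`): the per-bond price is `O(log η⁻¹)`. [folklore] -/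
theorem neg_log_haar_traceWindow_le {η : ℝ} (hη0 : 0 < η) (hη : η ≤ 1 / 4) :
    -Real.log ((haarProbability (Matrix.specialUnitaryGroup (Fin 2) ℂ)) {U : Matrix.specialUnitaryGroup (Fin 2) ℂ | 2 - ((U : Matrix (Fin 2) (Fin 2) ℂ).trace).re ≤ η}).toReal ≤ 2 * Real.log η⁻¹ + Real.log 16 := by
  have hpos : 0 < η ^ 2 / 16 := by positivity
  have hlog := Real.log_le_log hpos (haar_traceWindow_toReal_ge hη0 hη)
  rw [Real.log_div (by positivity) (by norm_num), Real.log_pow] at hlog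
  rw [Real.log_inv]
  push_cast at hlog
  linarith

/-- **THE TRACE DEFICIT IS THE SQUARED QUATERNION DISTANCE TO THE IDENTITY**: `‖su2Quat U − 1‖² = 2 − Re tr U` for `U ∈ SU(2)`
(`Re tr U = 2·re q`, `‖q‖ = 1`, `‖q − 1‖² = ‖q‖² − 2 re q + 1`). [folklore] -/
theorem norm_su2Quat_sub_one_sq (U : Matrix.specialUnitaryGroup (Fin 2) ℂ) :
    ‖su2Quat U - 1‖ ^ 2 = 2 - ((U : Matrix (Fin 2) (Fin 2) ℂ).trace).re := by
  have htr : ((U : Matrix (Fin 2) (Fin 2) ℂ).trace).re = 2 * (su2Quat U).re := by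
    conv_lhs => rw [← quatMatrix_su2Quat U]
    exact trace_quatMatrix_re _
  have h1 : (su2Quat U).re ^ 2 + (su2Quat U).imI ^ 2 + (su2Quat U).imJ ^ 2 + (su2Quat U).imK ^ 2 = 1 := by
    rw [← sq_norm_eq_sum_sq, norm_su2Quat, one_pow]
  rw [htr, sq_norm_eq_sum_sq, show (1 : ℍ) = ((1 : ℝ) : ℍ) from Quaternion.coe_one.symm]
  simp only [Quaternion.re_sub, Quaternion.re_coe, Quaternion.imI_sub, Quaternion.imI_coe, sub_zero, Quaternion.imJ_sub,
    Quaternion.imJ_coe, Quaternion.imK_sub, Quaternion.imK_coe]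
  nlinarith [h1]

/-- So the trace window IS the quaternion ball of radius `√η` around the identity: `{2 − Re tr U ≤ η} = {‖su2Quat U − 1‖ ≤ √η}`
(`η ≥ 0`) — the shape «`|V(b) − 1| ≤ ε`» of a bond small-field condition, at `η = ε²`. [folklore] -/
theorem traceWindow_eq_quatBall {η : ℝ} (hη : 0 ≤ η) :
    {U : Matrix.specialUnitaryGroup (Fin 2) ℂ | 2 - ((U : Matrix (Fin 2) (Fin 2) ℂ).trace).re ≤ η} = {U : (Matrix.specialUnitaryGroup (Fin 2) ℂ) | ‖su2Quat U - 1‖ ≤ Real.sqrt η} := by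
  ext U
  simp only [Set.mem_setOf_eq]
  rw [← norm_su2Quat_sub_one_sq, ← Real.sqrt_le_sqrt_iff hη, Real.sqrt_sq (norm_nonneg _)]

/-- The bond window in the `|V − 1| ≤ ε` shape has Haar mass `≥ ε⁴∕16` for `0 < ε ≤ 1∕2`. [folklore] -/
theorem haar_quatBall_toReal_ge {ε : ℝ} (hε0 : 0 < ε) (hε : ε ≤ 1 / 2) :
    ε ^ 4 / 16 ≤ ((haarProbability (Matrix.specialUnitaryGroup (Fin 2) ℂ)) {U : (Matrix.specialUnitaryGroup (Fin 2) ℂ) | ‖su2Quat U - 1‖ ≤ ε}).toReal := by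
  have hε2 : ε ^ 2 ≤ 1 / 4 := by nlinarith
  have h := haar_traceWindow_toReal_ge (pow_pos hε0 2) hε2
  rw [traceWindow_eq_quatBall (pow_pos hε0 2).le, Real.sqrt_sq hε0.le] at h
  calc ε ^ 4 / 16 = (ε ^ 2) ^ 2 / 16 := by ring
    _ ≤ _ := h

/-! ## §2 A region: the product Haar window over its bonds — mass `≥ (η²∕16)^{#bonds}`, `−log ≤ #bonds·(2 log η⁻¹ + log 16)` -/

section Region

variable {B : Type*} [Fintype B]

/-- **PRODUCT WINDOW, PRODUCT MASS** (the OWNER's `pi_window_measure` at equal factors): for the product Haar measure on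
`bonds → SU(2)` the product trace window has mass `Haar(W_η)^{#bonds}`. [folklore] -/
theorem pi_traceWindow_toReal_eq (η : ℝ) :
    ((Measure.pi fun _ : B => haarProbability (Matrix.specialUnitaryGroup (Fin 2) ℂ)) (Set.univ.pi fun _ : B => {U : Matrix.specialUnitaryGroup (Fin 2) ℂ | 2 - ((U : Matrix (Fin 2) (Fin 2) ℂ).trace).re ≤ η})).toReal
      = (((haarProbability (Matrix.specialUnitaryGroup (Fin 2) ℂ)) {U : Matrix.specialUnitaryGroup (Fin 2) ℂ | 2 - ((U : Matrix (Fin 2) (Fin 2) ℂ).trace).re ≤ η}).toReal) ^ Fintype.card B := by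
  rw [pi_window_measure, Finset.prod_const, Finset.card_univ]

/-- **`κ(W) ≥ (η²∕16)^{#bonds}`** for the product trace window (`0 < η ≤ 1∕4`). [folklore] -/
theorem pi_traceWindow_toReal_ge {η : ℝ} (hη0 : 0 < η) (hη : η ≤ 1 / 4) :
    (η ^ 2 / 16) ^ Fintype.card B ≤
      ((Measure.pi fun _ : B => haarProbability (Matrix.specialUnitaryGroup (Fin 2) ℂ)) (Set.univ.pi fun _ : B => {U : Matrix.specialUnitaryGroup (Fin 2) ℂ | 2 - ((U : Matrix (Fin 2) (Fin 2) ℂ).trace).re ≤ η})).toReal := by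
  rw [pi_traceWindow_toReal_eq]
  exact pow_le_pow_left₀ (by positivity) (haar_traceWindow_toReal_ge hη0 hη) _

/-- The product window has positive mass. [folklore] -/
theorem pi_traceWindow_toReal_pos {η : ℝ} (hη0 : 0 < η) (hη : η ≤ 1 / 4) :
    0 < ((Measure.pi fun _ : B => haarProbability (Matrix.specialUnitaryGroup (Fin 2) ℂ)) (Set.univ.pi fun _ : B => {U : Matrix.specialUnitaryGroup (Fin 2) ℂ | 2 - ((U : Matrix (Fin 2) (Fin 2) ℂ).trace).re ≤ η})).toReal :=
  lt_of_lt_of_le (by positivity) (pi_traceWindow_toReal_ge hη0 hη)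

/-- **THE PER-DEGREE-OF-FREEDOM PRICE BY VALUE**: `−log κ(W) ≤ #bonds · (2 log η⁻¹ + log 16)` for the product trace window of
half-width `η ∈ (0, 1∕4]` under the product Haar measure on `bonds → SU(2)` — «a per-site cost `O(1)(−log λ_j)`» with the `O(1)`
and the power named. [folklore] -/
theorem neg_log_pi_traceWindow_le {η : ℝ} (hη0 : 0 < η) (hη : η ≤ 1 / 4) :
    -Real.log ((Measure.pi fun _ : B => haarProbability (Matrix.specialUnitaryGroup (Fin 2) ℂ)) (Set.univ.pi fun _ : B => {U : Matrix.specialUnitaryGroup (Fin 2) ℂ | 2 - ((U : Matrix (Fin 2) (Fin 2) ℂ).trace).re ≤ η})).toReal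
      ≤ (Fintype.card B : ℝ) * (2 * Real.log η⁻¹ + Real.log 16) := by
  rw [pi_traceWindow_toReal_eq, Real.log_pow, ← mul_neg]
  exact mul_le_mul_of_nonneg_left (neg_log_haar_traceWindow_le hη0 hη) (Nat.cast_nonneg _)

end Region

/-! ## §3 The junction with the OWNER's compact-fibre moment bound -/

section Junction

variable {K Y : Type*} [MeasurableSpace K] [MeasurableSpace Y] (κ : Measure K) (μ : Measure Y) [IsProbabilityMeasure κ] [SFinite μ]

/-- **THE OWNER's DISPLAY WITH A WINDOW INDICATOR AS DENOMINATOR FACTOR**: near fibre a PROBABILITY space `(K, κ)`, window `W`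
measurable with `κ(W) > 0`, numerator near factor `0 ≤ F ≤ 1`, far weight `w ≥ 0`, interaction `I ≥ 0` wherever `F·w ≠ 0` and
`I ≤ i⁺` on `W × {w ≠ 0}`; then `∫ F·w·e^{−I} ≤ (e^{i⁺} ∕ κ(W)) · ∫ 𝟙_W·w·e^{−I}` (`compactFibre_moment_le` at `G = 𝟙_W`, with
`∫F dκ ≤ 1`). [folklore] -/
theorem compactFibre_moment_le_window (W : Set K) (hW : MeasurableSet W) (F : K → ℝ) (w : Y → ℝ) (I : K × Y → ℝ) {ip : ℝ}
    (hF0 : ∀ x, 0 ≤ F x) (hF1 : ∀ x, F x ≤ 1) (hFi : Integrable F κ) (hw0 : ∀ y, 0 ≤ w y)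
    (hIpos : ∀ z : K × Y, F z.1 ≠ 0 → w z.2 ≠ 0 → 0 ≤ I z)
    (hIsmall : ∀ z : K × Y, z.1 ∈ W → w z.2 ≠ 0 → I z ≤ ip)
    (hWpos : 0 < (κ W).toReal)
    (hA : Integrable (fun z : K × Y => F z.1 * w z.2) (κ.prod μ))
    (hB' : Integrable (fun z : K × Y => W.indicator 1 z.1 * w z.2 * exp (-I z)) (κ.prod μ)) :
    ∫ z, F z.1 * w z.2 * exp (-I z) ∂(κ.prod μ) ≤
      (exp ip / (κ W).toReal) * ∫ z, W.indicator 1 z.1 * w z.2 * exp (-I z) ∂(κ.prod μ) := by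
  have hG0 : ∀ x, 0 ≤ W.indicator (1 : K → ℝ) x := fun x => Set.indicator_nonneg (fun _ _ => zero_le_one) x
  have hGint : ∫ x, W.indicator (1 : K → ℝ) x ∂κ = (κ W).toReal := by
    rw [integral_indicator_one hW, measureReal_def]
  have hGpos : 0 < ∫ x, W.indicator (1 : K → ℝ) x ∂κ := by rw [hGint]; exact hWpos
  have hIsmall' : ∀ z : K × Y, W.indicator (1 : K → ℝ) z.1 ≠ 0 → w z.2 ≠ 0 → I z ≤ ip := fun z hz hw =>
    hIsmall z (Set.mem_of_indicator_ne_zero hz) hw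
  have key := compactFibre_moment_le κ μ F (W.indicator 1) w I hF0 hG0 hw0 hIpos hIsmall' hGpos hA hB'
  have hF_le : ∫ x, F x ∂κ ≤ 1 := by
    calc ∫ x, F x ∂κ ≤ ∫ _x, (1 : ℝ) ∂κ := integral_mono hFi (integrable_const 1) hF1
      _ = 1 := by simp
  have hR0 : 0 ≤ ∫ z, W.indicator (1 : K → ℝ) z.1 * w z.2 * exp (-I z) ∂(κ.prod μ) :=
    integral_nonneg fun z => mul_nonneg (mul_nonneg (hG0 _) (hw0 _)) (exp_pos _).le
  refine key.trans (mul_le_mul_of_nonneg_right ?_ hR0)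
  rw [hGint, div_eq_mul_inv, div_eq_mul_inv]
  exact mul_le_mul_of_nonneg_left (mul_le_of_le_one_left (inv_nonneg.mpr hWpos.le) hF_le) (exp_pos _).le

/-- And with a per-degree-of-freedom bound on the window volume, `−log κ(W) ≤ c`, the price is `≤ e^{i⁺ + c}`. [folklore] -/
theorem compactFibre_moment_le_window_exp (W : Set K) (hW : MeasurableSet W) (F : K → ℝ) (w : Y → ℝ) (I : K × Y → ℝ)
    {ip c : ℝ}
    (hF0 : ∀ x, 0 ≤ F x) (hF1 : ∀ x, F x ≤ 1) (hFi : Integrable F κ) (hw0 : ∀ y, 0 ≤ w y)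
    (hIpos : ∀ z : K × Y, F z.1 ≠ 0 → w z.2 ≠ 0 → 0 ≤ I z)
    (hIsmall : ∀ z : K × Y, z.1 ∈ W → w z.2 ≠ 0 → I z ≤ ip)
    (hWpos : 0 < (κ W).toReal) (hc : -Real.log (κ W).toReal ≤ c)
    (hA : Integrable (fun z : K × Y => F z.1 * w z.2) (κ.prod μ))
    (hB' : Integrable (fun z : K × Y => W.indicator 1 z.1 * w z.2 * exp (-I z)) (κ.prod μ)) :
    ∫ z, F z.1 * w z.2 * exp (-I z) ∂(κ.prod μ) ≤
      exp (ip + c) * ∫ z, W.indicator 1 z.1 * w z.2 * exp (-I z) ∂(κ.prod μ) := by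
  have key := compactFibre_moment_le_window κ μ W hW F w I hF0 hF1 hFi hw0 hIpos hIsmall hWpos hA hB'
  have hR0 : 0 ≤ ∫ z, W.indicator (1 : K → ℝ) z.1 * w z.2 * exp (-I z) ∂(κ.prod μ) :=
    integral_nonneg fun z => mul_nonneg (mul_nonneg (Set.indicator_nonneg (fun _ _ => zero_le_one) _) (hw0 _)) (exp_pos _).le
  refine key.trans (mul_le_mul_of_nonneg_right ?_ hR0)
  rw [exp_add, div_eq_mul_inv]
  refine mul_le_mul_of_nonneg_left ?_ (exp_pos _).le
  rw [← Real.exp_log (inv_pos.mpr hWpos), Real.log_inv]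
  exact Real.exp_le_exp.mpr hc

end Junction

/-- **THE JUNCTION FOR THE `SU(2)` PRODUCT FIBRE**: near fibre `bonds → SU(2)` with the product Haar probability (the near fibre of
the tree's `wilsonWeight`), window = the product trace window of half-width `η ∈ (0, 1∕4]`, numerator factor `0 ≤ F ≤ 1` carried by
POSITIVITY (`I ≥ 0` where `F·w ≠ 0`), interaction `≤ i⁺` on the window; then
`∫ F·w·e^{−I} d(κ⊗μ) ≤ exp(i⁺ + #bonds·(2 log η⁻¹ + log 16)) · ∫ 𝟙_W·w·e^{−I} d(κ⊗μ)` — the compact-fibre price with the volume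
letter BY VALUE. [folklore] -/
theorem compactFibre_moment_le_SU2window {B : Type*} [Fintype B] {Y : Type*} [MeasurableSpace Y] (μ : Measure Y) [SFinite μ]
    {η : ℝ} (hη0 : 0 < η) (hη : η ≤ 1 / 4)
    (F : (B → (Matrix.specialUnitaryGroup (Fin 2) ℂ)) → ℝ) (w : Y → ℝ) (I : (B → (Matrix.specialUnitaryGroup (Fin 2) ℂ)) × Y → ℝ) {ip : ℝ}
    (hF0 : ∀ x, 0 ≤ F x) (hF1 : ∀ x, F x ≤ 1) (hFi : Integrable F (Measure.pi fun _ : B => haarProbability (Matrix.specialUnitaryGroup (Fin 2) ℂ)))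
    (hw0 : ∀ y, 0 ≤ w y)
    (hIpos : ∀ z : (B → (Matrix.specialUnitaryGroup (Fin 2) ℂ)) × Y, F z.1 ≠ 0 → w z.2 ≠ 0 → 0 ≤ I z)
    (hIsmall : ∀ z : (B → (Matrix.specialUnitaryGroup (Fin 2) ℂ)) × Y, z.1 ∈ (Set.univ.pi fun _ : B => {U : Matrix.specialUnitaryGroup (Fin 2) ℂ | 2 - ((U : Matrix (Fin 2) (Fin 2) ℂ).trace).re ≤ η}) → w z.2 ≠ 0 → I z ≤ ip)
    (hA : Integrable (fun z : (B → (Matrix.specialUnitaryGroup (Fin 2) ℂ)) × Y => F z.1 * w z.2) ((Measure.pi fun _ : B => haarProbability (Matrix.specialUnitaryGroup (Fin 2) ℂ)).prod μ))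
    (hB' : Integrable (fun z : (B → (Matrix.specialUnitaryGroup (Fin 2) ℂ)) × Y => (Set.univ.pi fun _ : B => {U : Matrix.specialUnitaryGroup (Fin 2) ℂ | 2 - ((U : Matrix (Fin 2) (Fin 2) ℂ).trace).re ≤ η}).indicator 1 z.1 * w z.2 * exp (-I z))
      ((Measure.pi fun _ : B => haarProbability (Matrix.specialUnitaryGroup (Fin 2) ℂ)).prod μ)) :
    ∫ z, F z.1 * w z.2 * exp (-I z) ∂((Measure.pi fun _ : B => haarProbability (Matrix.specialUnitaryGroup (Fin 2) ℂ)).prod μ) ≤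
      exp (ip + (Fintype.card B : ℝ) * (2 * Real.log η⁻¹ + Real.log 16)) *
        ∫ z, (Set.univ.pi fun _ : B => {U : Matrix.specialUnitaryGroup (Fin 2) ℂ | 2 - ((U : Matrix (Fin 2) (Fin 2) ℂ).trace).re ≤ η}).indicator 1 z.1 * w z.2 * exp (-I z)
          ∂((Measure.pi fun _ : B => haarProbability (Matrix.specialUnitaryGroup (Fin 2) ℂ)).prod μ) :=
  compactFibre_moment_le_window_exp (Measure.pi fun _ : B => haarProbability (Matrix.specialUnitaryGroup (Fin 2) ℂ)) μ _
    (MeasurableSet.univ_pi fun _ => measurableSet_traceWindow η) F w I hF0 hF1 hFi hw0 hIpos hIsmall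
    (pi_traceWindow_toReal_pos hη0 hη) (neg_log_pi_traceWindow_le hη0 hη) hA hB'

/-! ## §4 The interaction letter `i⁺` on the window, by value: window bonds make window plaquettes (`SU(2)`) -/

/-- Unit quaternions: `‖p·q − 1‖ ≤ ‖p − 1‖ + ‖q − 1‖` (`p·q − 1 = p·(q − 1) + (p − 1)`, `‖p‖ = 1`). [folklore] -/
theorem norm_mul_sub_one_le {p : ℍ} (hp : ‖p‖ = 1) (q : ℍ) : ‖p * q - 1‖ ≤ ‖p - 1‖ + ‖q - 1‖ := by
  have h : p * (q - 1) + (p - 1) = p * q - 1 := by rw [mul_sub, mul_one, sub_add_sub_cancel]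
  calc ‖p * q - 1‖ = ‖p * (q - 1) + (p - 1)‖ := by rw [h]
    _ ≤ ‖p * (q - 1)‖ + ‖p - 1‖ := norm_add_le _ _
    _ = ‖q - 1‖ + ‖p - 1‖ := by rw [norm_mul, hp, one_mul]
    _ = ‖p - 1‖ + ‖q - 1‖ := add_comm _ _

/-- `Re tr U⁻¹ = Re tr U` on `SU(2)` (`U⁻¹ = U^*`). [folklore] -/
theorem re_trace_inv (U : Matrix.specialUnitaryGroup (Fin 2) ℂ) :
    (((U⁻¹ : Matrix.specialUnitaryGroup (Fin 2) ℂ) : Matrix (Fin 2) (Fin 2) ℂ).trace).re = ((U : Matrix (Fin 2) (Fin 2) ℂ).trace).re := by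
  rw [← Matrix.star_eq_inv]
  change ((star (U : Matrix (Fin 2) (Fin 2) ℂ)).trace).re = _
  rw [Matrix.star_eq_conjTranspose, Matrix.trace_conjTranspose, Complex.star_def, Complex.conj_re]

/-- The distance to the identity is inversion invariant: `‖su2Quat U⁻¹ − 1‖ = ‖su2Quat U − 1‖`. [folklore] -/
theorem norm_su2Quat_inv_sub_one (U : Matrix.specialUnitaryGroup (Fin 2) ℂ) : ‖su2Quat U⁻¹ - 1‖ = ‖su2Quat U - 1‖ := by
  have h := norm_su2Quat_sub_one_sq U⁻¹
  rw [re_trace_inv, ← norm_su2Quat_sub_one_sq] at h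
  exact (pow_left_inj₀ (norm_nonneg _) (norm_nonneg _) two_ne_zero).mp h

/-- `‖su2Quat (U·V) − 1‖ ≤ ‖su2Quat U − 1‖ + ‖su2Quat V − 1‖` (`su2Quat` is multiplicative, `T4HaarSU2Translate.su2Quat_mul`). [folklore] -/
theorem norm_su2Quat_mul_sub_one_le (U V : Matrix.specialUnitaryGroup (Fin 2) ℂ) : ‖su2Quat (U * V) - 1‖ ≤ ‖su2Quat U - 1‖ + ‖su2Quat V - 1‖ := by
  rw [su2Quat_mul]
  exact norm_mul_sub_one_le (norm_su2Quat U) _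

/-- Four factors (a plaquette holonomy `U₁U₂U₃U₄`, inverses already absorbed by `norm_su2Quat_inv_sub_one`). [folklore] -/
theorem norm_su2Quat_mul₄_sub_one_le (U₁ U₂ U₃ U₄ : Matrix.specialUnitaryGroup (Fin 2) ℂ) :
    ‖su2Quat (U₁ * U₂ * U₃ * U₄) - 1‖ ≤
      ‖su2Quat U₁ - 1‖ + ‖su2Quat U₂ - 1‖ + ‖su2Quat U₃ - 1‖ + ‖su2Quat U₄ - 1‖ := by
  have h12 := norm_su2Quat_mul_sub_one_le U₁ U₂
  have h123 := norm_su2Quat_mul_sub_one_le (U₁ * U₂) U₃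
  have h1234 := norm_su2Quat_mul_sub_one_le (U₁ * U₂ * U₃) U₄
  linarith

/-- **WINDOW BONDS MAKE WINDOW PLAQUETTES**: if the four bond variables lie in `W_η` (`η ≥ 0`) then their product lies in `W_{16η}`:
`2 − Re tr(U₁U₂U₃U₄) ≤ 16η`. [folklore] -/
theorem traceDeficit_mul₄_le {η : ℝ} (hη : 0 ≤ η) {U₁ U₂ U₃ U₄ : (Matrix.specialUnitaryGroup (Fin 2) ℂ)}
    (h₁ : U₁ ∈ {U : Matrix.specialUnitaryGroup (Fin 2) ℂ | 2 - ((U : Matrix (Fin 2) (Fin 2) ℂ).trace).re ≤ η}) (h₂ : U₂ ∈ {U : Matrix.specialUnitaryGroup (Fin 2) ℂ | 2 - ((U : Matrix (Fin 2) (Fin 2) ℂ).trace).re ≤ η}) (h₃ : U₃ ∈ {U : Matrix.specialUnitaryGroup (Fin 2) ℂ | 2 - ((U : Matrix (Fin 2) (Fin 2) ℂ).trace).re ≤ η}) (h₄ : U₄ ∈ {U : Matrix.specialUnitaryGroup (Fin 2) ℂ | 2 - ((U : Matrix (Fin 2) (Fin 2) ℂ).trace).re ≤ η}) :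
    2 - (((U₁ * U₂ * U₃ * U₄ : Matrix.specialUnitaryGroup (Fin 2) ℂ) : Matrix (Fin 2) (Fin 2) ℂ).trace).re ≤ 16 * η := by
  rw [traceWindow_eq_quatBall hη] at h₁ h₂ h₃ h₄
  simp only [Set.mem_setOf_eq] at h₁ h₂ h₃ h₄
  rw [← norm_su2Quat_sub_one_sq]
  have hle : ‖su2Quat (U₁ * U₂ * U₃ * U₄) - 1‖ ≤ 4 * Real.sqrt η := by
    linarith [norm_su2Quat_mul₄_sub_one_le U₁ U₂ U₃ U₄]
  have h0 : 0 ≤ ‖su2Quat (U₁ * U₂ * U₃ * U₄) - 1‖ := norm_nonneg _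
  have hs : Real.sqrt η ^ 2 = η := Real.sq_sqrt hη
  nlinarith

/-- The trace window is closed under inversion (`Re tr U⁻¹ = Re tr U`). [folklore] -/
theorem inv_mem_traceWindow {η : ℝ} {U : (Matrix.specialUnitaryGroup (Fin 2) ℂ)} (h : U ∈ {U : Matrix.specialUnitaryGroup (Fin 2) ℂ | 2 - ((U : Matrix (Fin 2) (Fin 2) ℂ).trace).re ≤ η}) : U⁻¹ ∈ {U : Matrix.specialUnitaryGroup (Fin 2) ℂ | 2 - ((U : Matrix (Fin 2) (Fin 2) ℂ).trace).re ≤ η} := by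
  simp only [Set.mem_setOf_eq] at h ⊢
  rwa [re_trace_inv]

/-- The PLAQUETTE WORD `U₁U₂U₃⁻¹U₄⁻¹` of four window bonds lies in `W_{16η}` (the two inverse bonds enter through `inv_mem_traceWindow`).
[folklore] -/
theorem traceDeficit_plaquetteWord_le {η : ℝ} (hη : 0 ≤ η) {U₁ U₂ U₃ U₄ : (Matrix.specialUnitaryGroup (Fin 2) ℂ)}
    (h₁ : U₁ ∈ {U : Matrix.specialUnitaryGroup (Fin 2) ℂ | 2 - ((U : Matrix (Fin 2) (Fin 2) ℂ).trace).re ≤ η}) (h₂ : U₂ ∈ {U : Matrix.specialUnitaryGroup (Fin 2) ℂ | 2 - ((U : Matrix (Fin 2) (Fin 2) ℂ).trace).re ≤ η}) (h₃ : U₃ ∈ {U : Matrix.specialUnitaryGroup (Fin 2) ℂ | 2 - ((U : Matrix (Fin 2) (Fin 2) ℂ).trace).re ≤ η}) (h₄ : U₄ ∈ {U : Matrix.specialUnitaryGroup (Fin 2) ℂ | 2 - ((U : Matrix (Fin 2) (Fin 2) ℂ).trace).re ≤ η}) :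
    2 - (((U₁ * U₂ * U₃⁻¹ * U₄⁻¹ : Matrix.specialUnitaryGroup (Fin 2) ℂ) : Matrix (Fin 2) (Fin 2) ℂ).trace).re ≤ 16 * η :=
  traceDeficit_mul₄_le hη h₁ h₂ (inv_mem_traceWindow h₃) (inv_mem_traceWindow h₄)

/-- Hence ONE Wilson plaquette term on the window is bounded by value: `β·(1 − ½ Re tr U_p) ≤ 8βη` (`β ≥ 0`). [folklore] -/
theorem wilsonPlaquette_le_of_window {β η : ℝ} (hβ : 0 ≤ β) (hη : 0 ≤ η) {U₁ U₂ U₃ U₄ : (Matrix.specialUnitaryGroup (Fin 2) ℂ)}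
    (h₁ : U₁ ∈ {U : Matrix.specialUnitaryGroup (Fin 2) ℂ | 2 - ((U : Matrix (Fin 2) (Fin 2) ℂ).trace).re ≤ η}) (h₂ : U₂ ∈ {U : Matrix.specialUnitaryGroup (Fin 2) ℂ | 2 - ((U : Matrix (Fin 2) (Fin 2) ℂ).trace).re ≤ η}) (h₃ : U₃ ∈ {U : Matrix.specialUnitaryGroup (Fin 2) ℂ | 2 - ((U : Matrix (Fin 2) (Fin 2) ℂ).trace).re ≤ η}) (h₄ : U₄ ∈ {U : Matrix.specialUnitaryGroup (Fin 2) ℂ | 2 - ((U : Matrix (Fin 2) (Fin 2) ℂ).trace).re ≤ η}) :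
    β * (1 - (1 / 2 : ℝ) * (((U₁ * U₂ * U₃ * U₄ : Matrix.specialUnitaryGroup (Fin 2) ℂ) : Matrix (Fin 2) (Fin 2) ℂ).trace).re) ≤ 8 * β * η := by
  have h := traceDeficit_mul₄_le hη h₁ h₂ h₃ h₄
  nlinarith

/-- **THE INTERACTION LETTER BY VALUE**: summed over the finitely many plaquettes touching the region, each of whose four bond
variables lies in `W_η`, the Wilson interaction is `≤ #plaquettes · 8βη =: i⁺`. [folklore] -/
theorem interaction_le_of_window {P : Type*} (s : Finset P) {β η : ℝ} (hβ : 0 ≤ β) (hη : 0 ≤ η) (b₁ b₂ b₃ b₄ : P → (Matrix.specialUnitaryGroup (Fin 2) ℂ))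
    (h : ∀ p ∈ s, b₁ p ∈ {U : Matrix.specialUnitaryGroup (Fin 2) ℂ | 2 - ((U : Matrix (Fin 2) (Fin 2) ℂ).trace).re ≤ η} ∧ b₂ p ∈ {U : Matrix.specialUnitaryGroup (Fin 2) ℂ | 2 - ((U : Matrix (Fin 2) (Fin 2) ℂ).trace).re ≤ η} ∧ b₃ p ∈ {U : Matrix.specialUnitaryGroup (Fin 2) ℂ | 2 - ((U : Matrix (Fin 2) (Fin 2) ℂ).trace).re ≤ η} ∧ b₄ p ∈ {U : Matrix.specialUnitaryGroup (Fin 2) ℂ | 2 - ((U : Matrix (Fin 2) (Fin 2) ℂ).trace).re ≤ η}) :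
    ∑ p ∈ s, β * (1 - (1 / 2 : ℝ) * (((b₁ p * b₂ p * b₃ p * b₄ p : Matrix.specialUnitaryGroup (Fin 2) ℂ) : Matrix (Fin 2) (Fin 2) ℂ).trace).re)
      ≤ (s.card : ℝ) * (8 * β * η) := by
  have key : ∀ p ∈ s,
      β * (1 - (1 / 2 : ℝ) * (((b₁ p * b₂ p * b₃ p * b₄ p : Matrix.specialUnitaryGroup (Fin 2) ℂ) : Matrix (Fin 2) (Fin 2) ℂ).trace).re) ≤ 8 * β * η :=
    fun p hp => wilsonPlaquette_le_of_window hβ hη (h p hp).1 (h p hp).2.1 (h p hp).2.2.1 (h p hp).2.2.2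
  calc _ ≤ ∑ _p ∈ s, 8 * β * η := Finset.sum_le_sum key
    _ = (s.card : ℝ) * (8 * β * η) := by rw [Finset.sum_const, nsmul_eq_mul]

/-! ## §5 Sanity (decidable arithmetic of the letter): at `η = 1∕4` one bond costs at most `2 log 4 + log 16 = log 256`; the
bound is linear in the number of bonds. -/

/-- The per-bond constant at the largest admissible window `η = 1∕4` is `log 256`. [folklore] -/
example : 2 * Real.log (1 / 4 : ℝ)⁻¹ + Real.log 16 = Real.log 256 := by
  rw [one_div, inv_inv, show (256 : ℝ) = 4 ^ 2 * 16 by norm_num, Real.log_mul (by norm_num) (by norm_num), Real.log_pow]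
  push_cast
  ring

end

end Summit.QuantumFields.BalabanUV.T4Continuum.NE7b.CompactFibreWindowSU2
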